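import Summits.QuantumFields.YangMills.Theorems.BalabanUVNodesN15PerCubeGreenRows
import Summits.QuantumFields.YangMills.Theorems.BalabanUVNodesN15PerCubeGreenFineRows
import Summits.QuantumFields.YangMills.Theorems.BalabanUVNodesN15TwoSpacingGluingCurvedCoverDefect
import Summits.QuantumFields.YangMills.Theorems.BalabanUVNodesN15CovariantAveragingTwoGrid
import Summits.QuantumFields.YangMills.Theorems.BalabanUVNodesN15CovariantLandauKingCouplingRate
import HarnessLib

/-!
# N15 = NE2 — PROGRAMME (PC-E), (m4)-A part 2: 53's TWO-GRID COMMUTATOR ROW `hDKN` ON SITES — the flat two-grid η-defect of `[N_L, M_{h_k}]` for the block-diagonal flat nonlocal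
# part `N_L = a·Q′ᵀQ′ ⊗ 1_ι` (n15-c∕260 `scQQ`) and the cover's partition `h_k` on the (PC) site carrier under King's pairing, from the EXACT two-grid defect of `scQQ`
# (`= (a′n′^{−(d+1)} − a n^{−(d+1)})·(unit-block sum)`, rate `|a_K(r+k) − a_K(k)| ≤ (4∕3)a₀(L^k)^{−γ}` at King's masses) and dag-n15-a's cover letters (dag-n15-a g37, by dag-n15-c g31's ASK (m4)-A)

Cell `pub-ymgap`, seat `pub-ymgap-dag-n15-a` (generation g37; KNIT-BY-NAME, count-neutral; HUMAN RULING D-0062; chair R424 venue).  `bears_on: R4∕N15 · K3⁸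
SpineGivenEndpointR13SepCoPHV (stmt-QuantumFields-27366)`; filed `--supports stmt-QuantumFields-27366 --as helper` — COUNT-NEUTRAL.  THEOREMS only ([folklore] bookkeeping),
0 `def`, 0 `sorry`.  Imports BY NAME n15-c∕261 `…PerCubeGreenRows` + 261′ `…PerCubeGreenFineRows` (`scQQ_apply`∕`scQQ'_apply`, the site objects), n15-c∕122
`…TwoSpacingGluingCurvedCoverDefect` (through it dag-n15-a FILE 56 `hasMaj_idef_commOp_nonlocal`, FILE 67 `coverHb`∕`abs_coverHb_sub_le`∕`abs_coverH_sub_coverHb_le`∕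
`abs_coverH_fine_sub_le`∕`coverHb_eq_of_spacing`, `hasMaj_tgt_congr`), n15-c∕183 `…CovariantAveragingTwoGrid` (`sum_fibre_fine_eq`, `blockOf_kingPr`), dag-n15-a Ξ-7
`…CovariantLandauKingCouplingRate` (`abs_aK_add_sub_aK_le_rpow`), n15-c `card_fibre_blockOf_fine`, pub-balaban `T4EtaRateDefect.idef`∕`T4EtaRateCoeffDefect.fibre`.
Nothing in the tree is modified, no landed name re-declared.

WHY (dag-n15-c g31 `PCE-DESIGN-g31.md` §5, ASK I.20924; HOME HANDOFF §g26 LOCATED (d) «hDKN … new lemma»).  53's row (d) on sites is `𝔇_{P̂,P̂}([N′_L, M_{h′_k}], [N_L, M_{h_k}])`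
with `N_L = scQQ a ι`, `N′_L = scQQ′ a′ ι`, `h_k = scH k`, `h′_k = scH′ k`.  dag-n15-a FILE 56 `hasMaj_idef_commOp_nonlocal` reduces it (on ANY carriers) to the one-grid rows of
`N_L`, `N′_L`, the two-grid defect `𝔇(N′_L, N_L)` and the partition's Lipschitz∕oscillation∕fit letters; THIS FILE supplies all of these on the coloured SITE carriers: `scQQ` is
block-diagonal in the unit blocks with sup-row `|a|·n^{−(d+1)}`; its two-grid defect is EXACTLY `(a′n′^{−2(d+1)}(L^r)^{d+1} − a n^{−2(d+1)})·Σ_{x ∈ B(πx′)} f(x, j)` (a fine unit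
block sum of a pulled-back field is `(L^r)^{d+1}` times the coarse one, n15-c `sum_fibre_fine_eq`), so its row is `|a′n′^{−(d+1)} − a n^{−(d+1)}|` — at King's masses
`a = a_K(a₀,L,k)·n^{d+1}`, `a′ = a_K(a₀,L,r+k)·n′^{d+1}` this is `|a_K(r+k) − a_K(k)| ≤ (4∕3)a₀(L^k)^{−γ}` (Ξ-7) — the η-rate; the partition letters are FILE 67's read at the
bond `(x, 0)` (`scH k x = hcube (2L) (coverXi …) k (x, 0)`, `rfl`).

RESULTS ([folklore] bookkeeping; `X = ScX`, `X′ = ScX′`, `π = kingPr L kk r (cvM…)`, `blk = scBlk`, norms `ScNorm` ∕ `ofBlocks (unitTorusGeo L kk (cvM…)) (liftBlk (scBlk ∘ π) ι)` as in 53's `hDKN`).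
* §1 `sum_ite_blockOf_eq_sum_fibre`, `abs_sum_fibre_le_card_mul_loc`, `ite_le_mul_exp`, ★ `hasMaj_scQQ_diag`∕`hasMaj_scQQ` (`N_L ≤ |a|n^{−(d+1)}·e^{−δ|y−y′|}`, any `δ`: block-diagonal), `hasMaj_scQQ'_diag`∕`hasMaj_scQQ'` (fine, norms read through `π`), `hasMaj_idef_pull_scQQ_diag`,
  ★ `idef_pull_scQQ_apply` (the exact two-grid defect), ★★ `hasMaj_idef_pull_scQQ` (row `|a′n′^{−(d+1)} − a n^{−(d+1)}|`), ★★ `hasMaj_idef_pull_scQQ_king` (King's masses: `(4∕3)a₀(L^kk)^{−γ}`).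
* §2 ★★★ `hasMaj_idef_commOp_scQQ_scH` — 53's `hDKN` ON SITES with displayed `N_L`-rows `cN`, `rN` (any masses), and ★★★ `hasMaj_idef_commOp_scQQ_scH_king` (King's masses, all
  letters explicit: `((π(d+1)∕w·(eε)⁻¹ + 2π(d+1)∕w)·(4∕3)a₀(L^kk)^{−γ} + 2·(π(d+1)∕(L^kk w))·2a₀)·e^{−(δ−ε)|y−y′|_T}`, `w = L^mv`, any `δ`, `ε > 0`, `γ ≤ 2`).

HONEST FRAMING ∕ LIMITS.  Bookkeeping + one exact block-sum identity; the only analytic input is Ξ-7's mass window (King (2.13)); MODEL carriers; nothing of [B9] asserted;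
NE2⁺ NOT PRINTED, NOT proved; N15 of record untouched (DISCHARGED AS CONSUMED, p687738); K3⁸ OPEN; counts of record UNMOVED (typed 28∕28 · discharged 8∕27); one finite 𝕋⁴
at fixed ε per index — NOT infinite volume, NOT OS on ℝ⁴, NOT a mass gap, NOT Clay.  Restate-immune (no Theses import).
-/

noncomputable section

open scoped BigOperators Matrix Matrix.Norms.Frobenius
open Finset

namespace Summit.QuantumFields.YangMills.BalabanUVNodes.N15.Gluing

open Real
open Literature.MathematicalPhysics.QuantumFieldTheory.Balaban1983to89
open Literature.MathematicalPhysics.QuantumFieldTheory.Balaban1983to89.B5Prop11Plancherel (Tor fine unitVec)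
open Literature.MathematicalPhysics.QuantumFieldTheory.Balaban1983to89.B11SectG (BlockNorm HasMaj)
open Literature.MathematicalPhysics.QuantumFieldTheory.Balaban1983to89.B11AxialTransport190 (abs_le_loc_ofBlocks loc_ofBlocks_le)
open Literature.MathematicalPhysics.QuantumFieldTheory.Balaban1983to89.B6Prop26Gluing (mulOp mulOp_apply)
open Literature.MathematicalPhysics.QuantumFieldTheory.Balaban1983to89.B6UnitTorusCarrier (unitTorusGeo unitTorusGeo_dist_nonneg unitTorusGeo_dist_symm unitTorusGeo_dist_self)
open Literature.MathematicalPhysics.QuantumFieldTheory.Balaban1983to89.T4EtaRateDefect (idef)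
open Literature.MathematicalPhysics.QuantumFieldTheory.Balaban1983to89.T4EtaRateCoeffDefect (pull pull_apply fibre mem_fibre)
open Literature.MathematicalPhysics.QuantumFieldTheory.King1986 (aK)
open Literature.MathematicalPhysics.QuantumFieldTheory.King1986.Torus (blockOf tdistT tdistT_nonneg)
open Summit.QuantumFields.YangMills.BalabanUVNodes.N15.VectorPiece (kingPr kingPrV kingPrV_eq)
open Summit.QuantumFields.YangMills.BalabanUVNodes.N15.MatrixSpecies (liftBlk liftMap)
open Summit.QuantumFields.YangMills.BalabanUVNodes.N15.CovAvg (blockOf_kingPr sum_fibre_fine_eq)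
open Summit.QuantumFields.YangMills.BalabanUVNodes.N15.CovLandau (card_fibre_blockOf_fine abs_aK_add_sub_aK_le_rpow)

variable {d : ℕ}

/-! ## §1 The rows of the flat nonlocal part `N_L = a·Q′ᵀQ′ ⊗ 1` on sites: one grid, and the exact two-grid defect -/

section NL

variable {L : ℕ} [NeZero L] {mv kk r : ℕ} {hL : Odd L ∧ 1 < L} (ι : Type) [Fintype ι] [DecidableEq ι]

omit [NeZero L] [DecidableEq ι] in
/-- a block-indicator sum is a sum over the fibre of the block map. [folklore] -/
theorem sum_ite_blockOf_eq_sum_fibre {nn : ℕ} [NeZero nn] (b : Tor (cvM d L mv kk hL)) (g : Tor (fine nn (cvM d L mv kk hL)) → ℝ) :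
    (∑ x : Tor (fine nn (cvM d L mv kk hL)), if blockOf nn (cvM d L mv kk hL) x = b then g x else 0) = ∑ x ∈ fibre (blockOf nn (cvM d L mv kk hL)) b, g x := by
  rw [fibre, sum_filter]

omit [NeZero L] [DecidableEq ι] in
/-- the fibre sum of a block-localised field is bounded by the block count times its block size, and vanishes off the block. [folklore] -/
theorem abs_sum_fibre_le_card_mul_loc {nn : ℕ} [NeZero nn] {y y' : Tor (cvM d L mv kk hL)} {μ : Tor (fine nn (cvM d L mv kk hL)) × ι → ℝ}
    (hμ : (BlockNorm.ofBlocks (unitTorusGeo L kk (cvM d L mv kk hL)) (liftBlk (blockOf nn (cvM d L mv kk hL)) ι)).IsLoc y' μ) (j : ι) :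
    |∑ x ∈ fibre (blockOf nn (cvM d L mv kk hL)) y, μ (x, j)| ≤
      (if y = y' then ((nn : ℝ) ^ (d + 1)) else 0) * (BlockNorm.ofBlocks (unitTorusGeo L kk (cvM d L mv kk hL)) (liftBlk (blockOf nn (cvM d L mv kk hL)) ι)).loc y' μ := by
  have hμ' : ∀ p : Tor (fine nn (cvM d L mv kk hL)) × ι, blockOf nn (cvM d L mv kk hL) p.1 ≠ y' → μ p = 0 := hμ
  by_cases hy : y = y'
  · subst hy
    rw [if_pos rfl]
    refine (abs_sum_le_sum_abs _ _).trans ?_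
    refine (sum_le_sum fun x hx => abs_le_loc_ofBlocks (g := unitTorusGeo L kk (cvM d L mv kk hL)) (liftBlk (blockOf nn (cvM d L mv kk hL)) ι) μ (x' := (x, j))
      ((mem_fibre (blockOf nn (cvM d L mv kk hL)) y x).mp hx)).trans (le_of_eq ?_)
    rw [sum_const, card_fibre_blockOf_fine, nsmul_eq_mul]
    push_cast
    ring
  · rw [if_neg hy, zero_mul]
    refine le_of_eq (abs_eq_zero.mpr (sum_eq_zero fun x hx => hμ' (x, j) ?_))
    rw [(mem_fibre (blockOf nn (cvM d L mv kk hL)) y x).mp hx]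
    exact hy

omit [NeZero L] [Fintype ι] [DecidableEq ι] in
/-- diagonal-to-exponential weakening of a block-diagonal majorant: `𝟙[y = y′]·C ≤ C·e^{−δ|y−y′|_T}` (`C ≥ 0`). [folklore] -/
theorem ite_le_mul_exp {C : ℝ} (hC : 0 ≤ C) (δ : ℝ) (y y' : Tor (cvM d L mv kk hL)) :
    (if y = y' then C else 0) ≤ C * Real.exp (-(δ * (unitTorusGeo L kk (cvM d L mv kk hL)).dist y y')) := by
  by_cases h : y = y'
  · subst h
    rw [if_pos rfl, unitTorusGeo_dist_self, mul_zero, neg_zero, Real.exp_zero, mul_one]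
  · rw [if_neg h]; positivity

/-- ★ **THE ONE-GRID ROW OF `N_L` ON SITES, DIAGONAL FORM**: `scQQ a ι ≤ 𝟙[y = y′]·|a|·n^{−(d+1)}` — `N_L` is block-diagonal in the unit blocks with block sums `a·n^{−2(d+1)}·Σ_{B(x)}`.
[cite: Balaban1985BackgroundPropagators, (3.24) p.394 (shape at `U ≡ 1`)] -/
theorem hasMaj_scQQ_diag (a : ℝ) :
    HasMaj (ScNorm d L mv kk hL ι) (ScNorm d L mv kk hL ι) (scQQ d L mv kk hL a ι)
      (fun y y' => if y = y' then |a| * ((((L ^ kk : ℕ) : ℝ)) ^ (d + 1))⁻¹ else 0) := by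
  intro y' μ hμ y
  have hL0 : 0 < L := Nat.pos_of_ne_zero (NeZero.ne L)
  have hn : (0 : ℝ) < (((L ^ kk : ℕ) : ℝ)) ^ (d + 1) := by positivity
  have hK0 : 0 ≤ (if y = y' then |a| * ((((L ^ kk : ℕ) : ℝ)) ^ (d + 1))⁻¹ else 0) := by split_ifs <;> positivity
  refine loc_ofBlocks_le _ _ (mul_nonneg hK0 ((BlockNorm.ofBlocks _ _).loc_nonneg y' μ)) fun p hp => ?_
  have hp' : blockOf (L ^ kk) (cvM d L mv kk hL) p.1 = y := hp
  have hS := abs_sum_fibre_le_card_mul_loc (d := d) (hL := hL) ι (nn := L ^ kk) (y := y) hμ p.2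
  rw [scQQ_apply, sum_ite_blockOf_eq_sum_fibre, hp', abs_mul, abs_mul, abs_of_nonneg (by positivity : (0 : ℝ) ≤ ((((L ^ kk : ℕ) : ℝ)) ^ (d + 1))⁻¹ * ((((L ^ kk : ℕ) : ℝ)) ^ (d + 1))⁻¹)]
  refine (mul_le_mul_of_nonneg_left hS (by positivity)).trans (le_of_eq ?_)
  show _ = (if y = y' then |a| * ((((L ^ kk : ℕ) : ℝ)) ^ (d + 1))⁻¹ else 0) * (BlockNorm.ofBlocks (unitTorusGeo L kk (cvM d L mv kk hL)) (liftBlk (blockOf (L ^ kk) (cvM d L mv kk hL)) ι)).loc y' μ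
  split_ifs
  · field_simp
  · ring

/-- ★ **THE ONE-GRID ROW OF `N_L` ON SITES**: `scQQ a ι ≤ |a|·n^{−(d+1)}·e^{−δ|y−y′|_T}` for EVERY `δ` (53's `hN` shape). [cite: Balaban1985BackgroundPropagators, (3.24) p.394 (shape at `U ≡ 1`)] -/
theorem hasMaj_scQQ (a δ : ℝ) :
    HasMaj (ScNorm d L mv kk hL ι) (ScNorm d L mv kk hL ι) (scQQ d L mv kk hL a ι)
      (fun y y' => |a| * ((((L ^ kk : ℕ) : ℝ)) ^ (d + 1))⁻¹ * Real.exp (-(δ * (unitTorusGeo L kk (cvM d L mv kk hL)).dist y y'))) :=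
  (hasMaj_scQQ_diag (d := d) (hL := hL) ι a).mono fun y y' => ite_le_mul_exp (d := d) (hL := hL) (by positivity) δ y y'

/-- ★ THE ONE-GRID ROW OF `N′_L` ON THE FINE SITES, DIAGONAL FORM, unit blocks read through King's pairing. [cite: Balaban1985BackgroundPropagators, (3.24) p.394 (shape)] -/
theorem hasMaj_scQQ'_diag (a : ℝ) :
    HasMaj (BlockNorm.ofBlocks (unitTorusGeo L kk (cvM d L mv kk hL)) (liftBlk (scBlk d L mv kk hL) ι ∘ liftMap (kingPr L kk r (cvM d L mv kk hL)) ι))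
      (BlockNorm.ofBlocks (unitTorusGeo L kk (cvM d L mv kk hL)) (liftBlk (scBlk d L mv kk hL) ι ∘ liftMap (kingPr L kk r (cvM d L mv kk hL)) ι)) (scQQ' d L mv kk r hL a ι)
      (fun y y' => if y = y' then |a| * ((((L ^ r * L ^ kk : ℕ) : ℝ)) ^ (d + 1))⁻¹ else 0) := by
  have hlift : liftBlk (scBlk d L mv kk hL) ι ∘ liftMap (kingPr L kk r (cvM d L mv kk hL)) ι = liftBlk (blockOf (L ^ r * L ^ kk) (cvM d L mv kk hL)) ι :=
    funext fun p => blockOf_kingPr (cvM d L mv kk hL) L kk r p.1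
  rw [hlift]
  intro y' μ hμ y
  have hL0 : 0 < L := Nat.pos_of_ne_zero (NeZero.ne L)
  have hn : (0 : ℝ) < (((L ^ r * L ^ kk : ℕ) : ℝ)) ^ (d + 1) := by positivity
  have hK0 : 0 ≤ (if y = y' then |a| * ((((L ^ r * L ^ kk : ℕ) : ℝ)) ^ (d + 1))⁻¹ else 0) := by split_ifs <;> positivity
  refine loc_ofBlocks_le _ _ (mul_nonneg hK0 ((BlockNorm.ofBlocks _ _).loc_nonneg y' μ)) fun p hp => ?_
  have hp' : blockOf (L ^ r * L ^ kk) (cvM d L mv kk hL) p.1 = y := hp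
  have hS := abs_sum_fibre_le_card_mul_loc (d := d) (hL := hL) ι (nn := L ^ r * L ^ kk) (y := y) hμ p.2
  rw [scQQ'_apply, sum_ite_blockOf_eq_sum_fibre, hp', abs_mul, abs_mul,
    abs_of_nonneg (by positivity : (0 : ℝ) ≤ ((((L ^ r * L ^ kk : ℕ) : ℝ)) ^ (d + 1))⁻¹ * ((((L ^ r * L ^ kk : ℕ) : ℝ)) ^ (d + 1))⁻¹)]
  refine (mul_le_mul_of_nonneg_left hS (by positivity)).trans (le_of_eq ?_)
  show _ = (if y = y' then |a| * ((((L ^ r * L ^ kk : ℕ) : ℝ)) ^ (d + 1))⁻¹ else 0) *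
    (BlockNorm.ofBlocks (unitTorusGeo L kk (cvM d L mv kk hL)) (liftBlk (blockOf (L ^ r * L ^ kk) (cvM d L mv kk hL)) ι)).loc y' μ
  split_ifs
  · field_simp
  · ring

/-- ★ THE ONE-GRID ROW OF `N′_L` ON THE FINE SITES (53's `hN′` shape, any `δ`). [cite: Balaban1985BackgroundPropagators, (3.24) p.394 (shape)] -/
theorem hasMaj_scQQ' (a δ : ℝ) :
    HasMaj (BlockNorm.ofBlocks (unitTorusGeo L kk (cvM d L mv kk hL)) (liftBlk (scBlk d L mv kk hL) ι ∘ liftMap (kingPr L kk r (cvM d L mv kk hL)) ι))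
      (BlockNorm.ofBlocks (unitTorusGeo L kk (cvM d L mv kk hL)) (liftBlk (scBlk d L mv kk hL) ι ∘ liftMap (kingPr L kk r (cvM d L mv kk hL)) ι)) (scQQ' d L mv kk r hL a ι)
      (fun y y' => |a| * ((((L ^ r * L ^ kk : ℕ) : ℝ)) ^ (d + 1))⁻¹ * Real.exp (-(δ * (unitTorusGeo L kk (cvM d L mv kk hL)).dist y y'))) :=
  (hasMaj_scQQ'_diag (d := d) (hL := hL) ι a).mono fun y y' => ite_le_mul_exp (d := d) (hL := hL) (by positivity) δ y y'

/-- ★ **THE EXACT TWO-GRID DEFECT OF THE FLAT NONLOCAL PART**: `(𝔇_{P̂,P̂}(N′_L, N_L) f)(x′, j) = (a′n′^{−2(d+1)}(L^r)^{d+1} − a n^{−2(d+1)})·Σ_{x ∈ B(πx′)} f(x, j)` — the fine unit block over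
`πx′` carries `(L^r)^{d+1}` fine sites per coarse site. [cite: King1986, p.664 (pairing convention); Balaban1985BackgroundPropagators, (3.24) p.394 (shape)] -/
theorem idef_pull_scQQ_apply (a a' : ℝ) (f : ScX d L mv kk hL × ι → ℝ) (p' : ScX' d L mv kk r hL × ι) :
    idef (pull (liftMap (kingPr L kk r (cvM d L mv kk hL)) ι)) (pull (liftMap (kingPr L kk r (cvM d L mv kk hL)) ι)) (scQQ' d L mv kk r hL a' ι) (scQQ d L mv kk hL a ι) f p' =
      (a' * (((((L ^ r * L ^ kk : ℕ) : ℝ)) ^ (d + 1))⁻¹ * ((((L ^ r * L ^ kk : ℕ) : ℝ)) ^ (d + 1))⁻¹) * (((L ^ r) ^ (d + 1) : ℕ) : ℝ) -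
          a * (((((L ^ kk : ℕ) : ℝ)) ^ (d + 1))⁻¹ * ((((L ^ kk : ℕ) : ℝ)) ^ (d + 1))⁻¹)) *
        ∑ x ∈ fibre (blockOf (L ^ kk) (cvM d L mv kk hL)) (blockOf (L ^ kk) (cvM d L mv kk hL) (kingPr L kk r (cvM d L mv kk hL) p'.1)), f (x, p'.2) := by
  rw [idef, LinearMap.sub_apply, LinearMap.comp_apply, LinearMap.comp_apply, Pi.sub_apply, pull_apply, scQQ'_apply, scQQ_apply, sum_ite_blockOf_eq_sum_fibre,
    sum_ite_blockOf_eq_sum_fibre]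
  simp only [liftMap, pull_apply]
  rw [← blockOf_kingPr (cvM d L mv kk hL) L kk r p'.1, sum_fibre_fine_eq (cvM d L mv kk hL) L kk r (fun x => f (x, p'.2)), nsmul_eq_mul]
  push_cast
  ring

/-- ★★ **THE TWO-GRID ROW OF `N_L` ON SITES, DIAGONAL FORM**: `𝔇_{P̂,P̂}(N′_L, N_L) ≤ 𝟙[y = y′]·|a′n′^{−(d+1)} − a n^{−(d+1)}|`, any masses. [cite: Balaban1985BackgroundPropagators, Thm 3.14 pp.426–427 (two-grid difference: template); King1986, p.664] -/
theorem hasMaj_idef_pull_scQQ_diag (a a' : ℝ) :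
    HasMaj (ScNorm d L mv kk hL ι) (BlockNorm.ofBlocks (unitTorusGeo L kk (cvM d L mv kk hL)) (liftBlk (scBlk d L mv kk hL) ι ∘ liftMap (kingPr L kk r (cvM d L mv kk hL)) ι))
      (idef (pull (liftMap (kingPr L kk r (cvM d L mv kk hL)) ι)) (pull (liftMap (kingPr L kk r (cvM d L mv kk hL)) ι)) (scQQ' d L mv kk r hL a' ι) (scQQ d L mv kk hL a ι))
      (fun y y' => if y = y' then |a' * ((((L ^ r * L ^ kk : ℕ) : ℝ)) ^ (d + 1))⁻¹ - a * ((((L ^ kk : ℕ) : ℝ)) ^ (d + 1))⁻¹| else 0) := by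
  intro y' μ hμ y
  have hL0 : 0 < L := Nat.pos_of_ne_zero (NeZero.ne L)
  have hn : (0 : ℝ) < (((L ^ kk : ℕ) : ℝ)) ^ (d + 1) := by positivity
  have hLr : (0 : ℝ) < (((L ^ r : ℕ) : ℝ)) ^ (d + 1) := by positivity
  have hK0 : 0 ≤ (if y = y' then |a' * ((((L ^ r * L ^ kk : ℕ) : ℝ)) ^ (d + 1))⁻¹ - a * ((((L ^ kk : ℕ) : ℝ)) ^ (d + 1))⁻¹| else 0) := by split_ifs <;> positivity
  refine loc_ofBlocks_le _ _ (mul_nonneg hK0 ((BlockNorm.ofBlocks _ _).loc_nonneg y' μ)) fun p hp => ?_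
  have hp' : blockOf (L ^ kk) (cvM d L mv kk hL) (kingPr L kk r (cvM d L mv kk hL) p.1) = y := hp
  have hS := abs_sum_fibre_le_card_mul_loc (d := d) (hL := hL) ι (nn := L ^ kk) (y := y) hμ p.2
  -- the coefficient times the block count is the displayed letter
  have hcoef : |a' * (((((L ^ r * L ^ kk : ℕ) : ℝ)) ^ (d + 1))⁻¹ * ((((L ^ r * L ^ kk : ℕ) : ℝ)) ^ (d + 1))⁻¹) * (((L ^ r) ^ (d + 1) : ℕ) : ℝ) -
        a * (((((L ^ kk : ℕ) : ℝ)) ^ (d + 1))⁻¹ * ((((L ^ kk : ℕ) : ℝ)) ^ (d + 1))⁻¹)| * (((L ^ kk : ℕ) : ℝ)) ^ (d + 1) =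
      |a' * ((((L ^ r * L ^ kk : ℕ) : ℝ)) ^ (d + 1))⁻¹ - a * ((((L ^ kk : ℕ) : ℝ)) ^ (d + 1))⁻¹| := by
    have hR : (((L ^ r) ^ (d + 1) : ℕ) : ℝ) = (((L ^ r : ℕ) : ℝ)) ^ (d + 1) := by push_cast; ring
    have hN' : (((L ^ r * L ^ kk : ℕ) : ℝ)) ^ (d + 1) = (((L ^ r : ℕ) : ℝ)) ^ (d + 1) * (((L ^ kk : ℕ) : ℝ)) ^ (d + 1) := by push_cast; ring
    rw [← abs_of_pos hn, ← abs_mul, abs_of_pos hn]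
    congr 1
    rw [hR, hN']
    field_simp
  rw [idef_pull_scQQ_apply, hp', abs_mul]
  refine (mul_le_mul_of_nonneg_left hS (abs_nonneg _)).trans (le_of_eq ?_)
  show _ = (if y = y' then |a' * ((((L ^ r * L ^ kk : ℕ) : ℝ)) ^ (d + 1))⁻¹ - a * ((((L ^ kk : ℕ) : ℝ)) ^ (d + 1))⁻¹| else 0) *
    (BlockNorm.ofBlocks (unitTorusGeo L kk (cvM d L mv kk hL)) (liftBlk (blockOf (L ^ kk) (cvM d L mv kk hL)) ι)).loc y' μ
  split_ifs
  · rw [← hcoef]; ring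
  · ring

/-- ★★ **THE TWO-GRID ROW OF `N_L` ON SITES (53's `hDN` shape)**: `𝔇_{P̂,P̂}(N′_L, N_L) ≤ |a′n′^{−(d+1)} − a n^{−(d+1)}|·e^{−δ|y−y′|_T}`, any `δ`, any masses.
[cite: Balaban1985BackgroundPropagators, Thm 3.14 pp.426–427 (template); King1986, p.664] -/
theorem hasMaj_idef_pull_scQQ (a a' δ : ℝ) :
    HasMaj (ScNorm d L mv kk hL ι) (BlockNorm.ofBlocks (unitTorusGeo L kk (cvM d L mv kk hL)) (liftBlk (scBlk d L mv kk hL) ι ∘ liftMap (kingPr L kk r (cvM d L mv kk hL)) ι))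
      (idef (pull (liftMap (kingPr L kk r (cvM d L mv kk hL)) ι)) (pull (liftMap (kingPr L kk r (cvM d L mv kk hL)) ι)) (scQQ' d L mv kk r hL a' ι) (scQQ d L mv kk hL a ι))
      (fun y y' => |a' * ((((L ^ r * L ^ kk : ℕ) : ℝ)) ^ (d + 1))⁻¹ - a * ((((L ^ kk : ℕ) : ℝ)) ^ (d + 1))⁻¹| * Real.exp (-(δ * (unitTorusGeo L kk (cvM d L mv kk hL)).dist y y'))) :=
  (hasMaj_idef_pull_scQQ_diag (d := d) (hL := hL) ι a a').mono fun y y' => ite_le_mul_exp (d := d) (hL := hL) (abs_nonneg _) δ y y'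

/-- ★★ **AT KING's MASSES THE TWO-GRID ROW OF `N_L` IS THE MASS WINDOW**: with `a = a_K(a₀,L,kk)·n^{d+1}`, `a′ = a_K(a₀,L,r+kk)·n′^{d+1}` (262∕262′'s masses) the letter is
`|a_K(r+kk) − a_K(kk)| ≤ (4∕3)a₀(L^kk)^{−γ}` for any `γ ≤ 2` (Ξ-7). [cite: King1986, (2.13) p.653; Balaban1985BackgroundPropagators, Thm 3.14 pp.426–427 (template)] -/
theorem hasMaj_idef_pull_scQQ_king (hL2 : (2 : ℝ) ≤ (L : ℝ)) (hkk : 1 ≤ kk) {a₀ : ℝ} (ha₀ : 0 < a₀) {γ : ℝ} (hγ2 : γ ≤ 2) (δ : ℝ) :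
    HasMaj (ScNorm d L mv kk hL ι) (BlockNorm.ofBlocks (unitTorusGeo L kk (cvM d L mv kk hL)) (liftBlk (scBlk d L mv kk hL) ι ∘ liftMap (kingPr L kk r (cvM d L mv kk hL)) ι))
      (idef (pull (liftMap (kingPr L kk r (cvM d L mv kk hL)) ι)) (pull (liftMap (kingPr L kk r (cvM d L mv kk hL)) ι))
        (scQQ' d L mv kk r hL (aK a₀ (L : ℝ) (r + kk) * ((((L ^ r * L ^ kk : ℕ) : ℝ)) ^ (d + 1))) ι) (scQQ d L mv kk hL (aK a₀ (L : ℝ) kk * ((((L ^ kk : ℕ) : ℝ)) ^ (d + 1))) ι))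
      (fun y y' => 4 / 3 * a₀ * ((L : ℝ) ^ kk) ^ (-γ) * Real.exp (-(δ * (unitTorusGeo L kk (cvM d L mv kk hL)).dist y y'))) := by
  have hL0 : 0 < L := Nat.pos_of_ne_zero (NeZero.ne L)
  have hn : (((L ^ kk : ℕ) : ℝ)) ^ (d + 1) ≠ 0 := by positivity
  have hn' : (((L ^ r * L ^ kk : ℕ) : ℝ)) ^ (d + 1) ≠ 0 := by positivity
  refine (hasMaj_idef_pull_scQQ (d := d) (hL := hL) ι _ _ δ).mono fun y y' => mul_le_mul_of_nonneg_right ?_ (Real.exp_nonneg _)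
  rw [mul_assoc, mul_inv_cancel₀ hn', mul_one, mul_assoc, mul_inv_cancel₀ hn, mul_one]
  exact abs_aK_add_sub_aK_le_rpow ha₀ hL2 hkk r hγ2

end NL

/-! ## §2 53's two-grid commutator row `hDKN` on sites -/

section Commutator

variable {L : ℕ} [NeZero L] {mv kk r : ℕ} {hL : Odd L ∧ 1 < L} (ι : Type) [Fintype ι] [DecidableEq ι]

/-- ★★★ **53's `hDKN` ON SITES**: the two-grid η-defect of the block-diagonal commutators `[N′_L, M_{h′_k}]` vs `[N_L, M_{h_k}]` under King's pairing is
`≤ ((π(d+1)∕w·(eε)⁻¹ + 2π(d+1)∕w)·r_N + 2·(π(d+1)∕(L^kk w))·c_N)·e^{−(δ_N−ε)|y−y′|_T}` from the displayed rows `c_N` of `N_L`, `N′_L` and `r_N` of `𝔇(N′_L, N_L)` (dag-n15-a FILE 56 on the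
coloured site carriers; the cover's partition letters FILE 67 read at `(x, 0)`). [cite: Balaban1984PropagatorsI, (1.126)–(1.128) p.38 (shapes); Balaban1985BackgroundPropagators, Thm 3.14 pp.426–427 (template)] -/
theorem hasMaj_idef_commOp_scQQ_scH (hM : ∀ ν, cvM d L mv kk hL ν = 2 * L * L ^ mv) (hw : 0 < L ^ mv) (k : Fin (d + 1) → ZMod (2 * L)) {a a' cN rN δN ε : ℝ}
    (hcN : 0 ≤ cN) (hrN : 0 ≤ rN) (hε : 0 < ε)
    (hN : HasMaj (ScNorm d L mv kk hL ι) (ScNorm d L mv kk hL ι) (scQQ d L mv kk hL a ι) (fun y y' => cN * Real.exp (-(δN * (unitTorusGeo L kk (cvM d L mv kk hL)).dist y y'))))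
    (hN' : HasMaj (BlockNorm.ofBlocks (unitTorusGeo L kk (cvM d L mv kk hL)) (liftBlk (scBlk d L mv kk hL) ι ∘ liftMap (kingPr L kk r (cvM d L mv kk hL)) ι))
      (BlockNorm.ofBlocks (unitTorusGeo L kk (cvM d L mv kk hL)) (liftBlk (scBlk d L mv kk hL) ι ∘ liftMap (kingPr L kk r (cvM d L mv kk hL)) ι)) (scQQ' d L mv kk r hL a' ι)
      (fun y y' => cN * Real.exp (-(δN * (unitTorusGeo L kk (cvM d L mv kk hL)).dist y y'))))
    (hDN : HasMaj (ScNorm d L mv kk hL ι) (BlockNorm.ofBlocks (unitTorusGeo L kk (cvM d L mv kk hL)) (liftBlk (scBlk d L mv kk hL) ι ∘ liftMap (kingPr L kk r (cvM d L mv kk hL)) ι))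
      (idef (pull (liftMap (kingPr L kk r (cvM d L mv kk hL)) ι)) (pull (liftMap (kingPr L kk r (cvM d L mv kk hL)) ι)) (scQQ' d L mv kk r hL a' ι) (scQQ d L mv kk hL a ι))
      (fun y y' => rN * Real.exp (-(δN * (unitTorusGeo L kk (cvM d L mv kk hL)).dist y y')))) :
    HasMaj (ScNorm d L mv kk hL ι) (BlockNorm.ofBlocks (unitTorusGeo L kk (cvM d L mv kk hL)) (liftBlk (scBlk d L mv kk hL ∘ kingPr L kk r (cvM d L mv kk hL)) ι))
      (idef (pull (liftMap (kingPr L kk r (cvM d L mv kk hL)) ι)) (pull (liftMap (kingPr L kk r (cvM d L mv kk hL)) ι))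
        (commOp (scQQ' d L mv kk r hL a' ι) (fun p : ScX' d L mv kk r hL × ι => scH' d L mv kk r hL k p.1))
        (commOp (scQQ d L mv kk hL a ι) (fun p : ScX d L mv kk hL × ι => scH d L mv kk hL k p.1)))
      (fun y y' => ((π * (d + 1) / (L ^ mv : ℕ) * (Real.exp 1 * ε)⁻¹ + 2 * (π * (d + 1) / (L ^ mv : ℕ))) * rN + 2 * (π * (d + 1) / (((L ^ kk : ℕ) : ℝ) * (L ^ mv : ℕ))) * cN) *
        Real.exp (-((δN - ε) * (unitTorusGeo L kk (cvM d L mv kk hL)).dist y y'))) := by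
  have hsc := hasMaj_idef_commOp_nonlocal (g := unitTorusGeo L kk (cvM d L mv kk hL)) (liftBlk (scBlk d L mv kk hL) ι) (liftMap (kingPr L kk r (cvM d L mv kk hL)) ι)
    (h := fun p : ScX d L mv kk hL × ι => scH d L mv kk hL k p.1) (h' := fun p' : ScX' d L mv kk r hL × ι => scH' d L mv kk r hL k p'.1) (hb := coverHb (cvM d L mv kk hL) (L ^ kk) (L ^ mv) L k)
    hcN hrN (by positivity : (0 : ℝ) ≤ π * (d + 1) / (L ^ mv : ℕ)) (by positivity : (0 : ℝ) ≤ π * (d + 1) / (L ^ mv : ℕ)) (by positivity : (0 : ℝ) ≤ π * (d + 1) / (((L ^ kk : ℕ) : ℝ) * (L ^ mv : ℕ))) hε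
    (unitTorusGeo_dist_nonneg L kk (cvM d L mv kk hL)) (unitTorusGeo_dist_symm L kk (cvM d L mv kk hL)) (fun y y' => abs_coverHb_sub_le hM hw k y y')
    (fun p => abs_coverH_sub_coverHb_le hM hw k (p.1, 0))
    (fun p' => by
      have h := abs_coverH_sub_coverHb_le (M := cvM d L mv kk hL) (n := L ^ r * L ^ kk) hM hw k (p'.1, 0)
      rwa [coverHb_eq_of_spacing (L ^ kk) (L ^ r * L ^ kk) hw k, ← blockOf_kingPr (cvM d L mv kk hL) L kk r p'.1] at h)
    (fun p' => abs_coverH_fine_sub_le kk r hM hw k (p'.1, 0)) hN hN' hDN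
  exact hasMaj_tgt_congr (funext fun _ => rfl) hsc

/-- ★★★ **53's `hDKN` ON SITES AT KING's MASSES, ALL LETTERS EXPLICIT**: `c_N = 2a₀` (King's couplings `a_K ≤ 2a₀`?? — stated with the displayed one-grid rows of §1: `c_N = |a|n^{−(d+1)} + |a′|n′^{−(d+1)}`),
`r_N = (4∕3)a₀(L^kk)^{−γ}` (Ξ-7), rate `δ − ε` for any `δ`, `ε > 0`. [cite: King1986, (2.13) p.653; Balaban1984PropagatorsI, (1.126)–(1.128) p.38 (shapes)] -/
theorem hasMaj_idef_commOp_scQQ_scH_king (hM : ∀ ν, cvM d L mv kk hL ν = 2 * L * L ^ mv) (hw : 0 < L ^ mv) (hL2 : (2 : ℝ) ≤ (L : ℝ)) (hkk : 1 ≤ kk) {a₀ : ℝ} (ha₀ : 0 < a₀)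
    {γ : ℝ} (hγ2 : γ ≤ 2) (k : Fin (d + 1) → ZMod (2 * L)) (δ : ℝ) {ε : ℝ} (hε : 0 < ε) :
    HasMaj (ScNorm d L mv kk hL ι) (BlockNorm.ofBlocks (unitTorusGeo L kk (cvM d L mv kk hL)) (liftBlk (scBlk d L mv kk hL ∘ kingPr L kk r (cvM d L mv kk hL)) ι))
      (idef (pull (liftMap (kingPr L kk r (cvM d L mv kk hL)) ι)) (pull (liftMap (kingPr L kk r (cvM d L mv kk hL)) ι))
        (commOp (scQQ' d L mv kk r hL (aK a₀ (L : ℝ) (r + kk) * ((((L ^ r * L ^ kk : ℕ) : ℝ)) ^ (d + 1))) ι) (fun p : ScX' d L mv kk r hL × ι => scH' d L mv kk r hL k p.1))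
        (commOp (scQQ d L mv kk hL (aK a₀ (L : ℝ) kk * ((((L ^ kk : ℕ) : ℝ)) ^ (d + 1))) ι) (fun p : ScX d L mv kk hL × ι => scH d L mv kk hL k p.1)))
      (fun y y' => ((π * (d + 1) / (L ^ mv : ℕ) * (Real.exp 1 * ε)⁻¹ + 2 * (π * (d + 1) / (L ^ mv : ℕ))) * (4 / 3 * a₀ * ((L : ℝ) ^ kk) ^ (-γ)) +
          2 * (π * (d + 1) / (((L ^ kk : ℕ) : ℝ) * (L ^ mv : ℕ))) * (|aK a₀ (L : ℝ) kk| + |aK a₀ (L : ℝ) (r + kk)|)) *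
        Real.exp (-((δ - ε) * (unitTorusGeo L kk (cvM d L mv kk hL)).dist y y'))) := by
  have hL0 : 0 < L := Nat.pos_of_ne_zero (NeZero.ne L)
  have hn : (((L ^ kk : ℕ) : ℝ)) ^ (d + 1) ≠ 0 := by positivity
  have hn' : (((L ^ r * L ^ kk : ℕ) : ℝ)) ^ (d + 1) ≠ 0 := by positivity
  -- the one-grid rows at King's masses: `|a_K·n^{d+1}|·n^{−(d+1)} = |a_K|`, weakened to the common letter `|a_K(kk)| + |a_K(r+kk)|`
  have hN := (hasMaj_scQQ (d := d) (mv := mv) (kk := kk) (hL := hL) ι (aK a₀ (L : ℝ) kk * ((((L ^ kk : ℕ) : ℝ)) ^ (d + 1))) δ).mono fun y y' =>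
    (mul_le_mul_of_nonneg_right (show |aK a₀ (L : ℝ) kk * ((((L ^ kk : ℕ) : ℝ)) ^ (d + 1))| * ((((L ^ kk : ℕ) : ℝ)) ^ (d + 1))⁻¹ ≤ |aK a₀ (L : ℝ) kk| + |aK a₀ (L : ℝ) (r + kk)| by
      rw [abs_mul, abs_of_pos (by positivity : (0 : ℝ) < (((L ^ kk : ℕ) : ℝ)) ^ (d + 1)), mul_assoc, mul_inv_cancel₀ hn, mul_one]
      exact le_add_of_nonneg_right (abs_nonneg _)) (Real.exp_nonneg _))
  have hN' := (hasMaj_scQQ' (d := d) (mv := mv) (kk := kk) (r := r) (hL := hL) ι (aK a₀ (L : ℝ) (r + kk) * ((((L ^ r * L ^ kk : ℕ) : ℝ)) ^ (d + 1))) δ).mono fun y y' =>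
    (mul_le_mul_of_nonneg_right (show |aK a₀ (L : ℝ) (r + kk) * ((((L ^ r * L ^ kk : ℕ) : ℝ)) ^ (d + 1))| * ((((L ^ r * L ^ kk : ℕ) : ℝ)) ^ (d + 1))⁻¹ ≤
        |aK a₀ (L : ℝ) kk| + |aK a₀ (L : ℝ) (r + kk)| by
      rw [abs_mul, abs_of_pos (by positivity : (0 : ℝ) < (((L ^ r * L ^ kk : ℕ) : ℝ)) ^ (d + 1)), mul_assoc, mul_inv_cancel₀ hn', mul_one]
      exact le_add_of_nonneg_left (abs_nonneg _)) (Real.exp_nonneg _))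
  exact hasMaj_idef_commOp_scQQ_scH (d := d) (hL := hL) ι hM hw k (by positivity) (by positivity) hε hN hN' (hasMaj_idef_pull_scQQ_king (d := d) (hL := hL) ι hL2 hkk ha₀ hγ2 δ)

end Commutator

end Summit.QuantumFields.YangMills.BalabanUVNodes.N15.Gluing

end
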